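import Literature.Geometry.MetricGeometry.GromovHausdorffApprox
import Literature.Geometry.Riemannian.VolumeSphereTheoremGHDecompositionProofs
import Mathlib.Analysis.InnerProductSpace.PiL2
import Mathlib.Topology.MetricSpace.DilationEquiv
import Mathlib.Topology.MetricSpace.GromovHausdorff
import HarnessLib

/-!
# The uniform `(ε, r)`-Reifenberg condition of Cheeger–Colding

Cheeger–Colding, *On the structure of spaces with Ricci curvature bounded below. I*, J. Differential
Geom. 46 (1997), (4.6) p. 431 and Appendix 1, p. 457. For a metric space `Y`, `y ∈ Y`, `0 ∈ ℝⁿ`: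

* (4.6) (with the factor `X` a point): `d_GH(B_s(y), B_s(0)) < ε s`;
* `(ℛ_n)_{ε,r}` "denote[s] the set of points such that for some `u > r`, (4.6) holds for all
  `s ∈ (0, u]`" (p. 457);
* `𝓜(n, ε, r)` "denote[s] the collection of isometry classes of complete separable metric spaces,
  `(Z, ρ)`, such that `z ∈ (ℛ_n)_{ε,r}`, for all `z ∈ Z`" (p. 457) — the hypothesis of the intrinsic
  Reifenberg theorems A.1.2–A.1.4 and, through Thm A.1.5 (Colding 1997), of A.1.8–A.1.12.

This file supplies the notion as predicates on (pseudo)metric spaces, in the tree's working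
vocabulary of `ε`-Gromov–Hausdorff approximations (`Literature.Geometry.MetricGeometry.IsGHApprox`:
distortion `≤ ε`, `ε`-dense image; Colding 1997 *Aspects*, Def. 2.1 and the remark after it):

§1. `IsReifenbergPoint n ε r z` — `z ∈ (ℛ_n)_{ε,r}`: for every scale `0 < s ≤ r` there is an
`(ε s)`-GH approximation from the closed ball `B̄_s(z)` (subtype metric) to the closed Euclidean
ball `B̄_s(0) ⊂ EuclideanSpace ℝ (Fin n)`; and `IsUniformlyReifenberg n X ε r` — `[X] ∈ 𝓜(n, ε, r)`:
every point of `X` is an `(ε, r)`-Reifenberg point. API: unfolding, monotonicity in `ε` and `r`,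
`0 ≤ ε`, vacuity for `r ≤ 0`, the equivalent GLOBAL-MAP form (a map `φ : X → ℝⁿ` sending `B̄_s(z)`
into `B̄_s(0)` with distortion `≤ ε s` there and `(ε s)`-dense image), transport along surjective
distance-scaling bijections (isometries: same `(ε, r)`; dilations by `λ`: `(ε, λ r)` — the scale
behaviour under `ρ ↦ λ ρ`).

§2. THE MODEL: `ℝⁿ` — and every `n`-dimensional real inner product space — is uniformly
`(ε, r)`-Reifenberg for all `ε ≥ 0` and all `r` (translation + an orthonormal frame give a
`0`-approximation); and any `n`-dimensional real inner product space may replace `ℝⁿ` as the model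
of the balls (`isReifenbergPoint_of_finrank_eq`, used for the round sphere in the sibling file
`UniformlyReifenbergSphere.lean`, where the model is the tangent hyperplane).

§3. BRIDGE TO THE PRINTED `d_GH`-FORM (Mathlib's `GromovHausdorff.ghDist`, which needs compact
nonempty spaces, e.g. closed balls of a proper metric space): the literal (4.6)-predicate
`IsUniformlyReifenbergGH n X ε r` (`d_GH(B̄_s(z), B̄_s(0)) < ε s` for all `z`, `0 < s ≤ r`) on proper
metric spaces, and the two comparisons `IsUniformlyReifenberg n X ε r → IsUniformlyReifenbergGH n X
(2ε) r` (`ε > 0`; from `IsGHApprox.ghDist_le`, constant `3/2 < 2`) and `IsUniformlyReifenbergGH n X ε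
r → IsUniformlyReifenberg n X (2ε) r` (from `exists_isGHApprox_of_ghDist_lt`). So the two renderings
agree up to the factor `2`, which the quantifiers `∃ ε(n)` of Thms A.1.1–A.1.5 absorb.

§4. THE RIEMANNIAN SPECIALISATION `IsUniformlyReifenbergRiem n h ε r` for a `C^∞` Riemannian metric
`h` on a connected `n`-manifold `M`: `IsUniformlyReifenberg n M ε r` for the metric space structure
`metricSpaceOfRiemannian` of the length distance `d_h = Manifold.riemannianEDist` (finite on connected
manifolds, `VolumeSphereTheoremGHDecompositionProofs` §1, §4) — the form in which Thm A.1.12 /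
`CheegerColding1997_sphereStability` consumes it — with its unfolding in terms of `riemannianEDist`.

## Faithfulness

* Balls: the printed `B_s(y)` are rendered as CLOSED balls with the restricted (subtype) metric
  (compact in proper spaces, so that §3 can speak of Mathlib's `ghDist`); for the length spaces of
  the source the closed ball is the closure of the open one and `d_GH` does not see the difference.
* Scales: the printed "for some `u > r`, for all `s ∈ (0, u]`" is rendered as "for all
  `s ∈ (0, r]`"; printed `(ε, r)` implies ours at `(ε, r)`, ours at `(ε, r)` implies printed
  `(ε, r')` for every `r' < r`.
* `d_GH < ε s` versus an `(ε s)`-approximation: equivalent up to the factor `2` (§3).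
* Completeness / separability of the members of `𝓜(n, ε, r)` are NOT part of the predicate; they
  are hypotheses of the theorems (A.1.1: "complete metric space"), to be stated there.
* Degenerate parameters: for `r ≤ 0` the condition is vacuous (`isUniformlyReifenberg_of_nonpos`);
  for `r > 0` and `X` nonempty it forces `0 ≤ ε` (`IsUniformlyReifenberg.nonneg`).

## References

* J. Cheeger, T. H. Colding, *On the structure of spaces with Ricci curvature bounded below. I*,
  J. Differential Geom. 46 (1997) 406–480: (4.6) p. 431; Appendix 1, p. 457 (`(ℛ_n)_{ε,r}`,
  `𝓜(n, ε, r)`, Thms A.1.1–A.1.3), p. 458 (Thm A.1.5). Read: `lit read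
  doi:10.4310/jdg/1214459974`, PDF pp. 26, 52–53. [CheegerColding1997]
* T. H. Colding, *Aspects of Ricci curvature*, Comparison Geometry, MSRI Publ. 30 (1997), Def. 2.1
  and the remark following it (p. 87). [Colding1997Aspects]
-/

noncomputable section

open Metric Set Function
open Literature.Geometry.MetricGeometry

namespace Literature.Geometry.Riemannian

/-! ### §1. Reifenberg points and uniformly Reifenberg spaces -/

section Basic

/-- **`z ∈ (ℛ_n)_{ε,r}`: `z` is an `(ε, r)`-Reifenberg point** of the (pseudo)metric space `X`
(Cheeger–Colding 1997, (4.6) p. 431 with the factor `X` a point, and Appendix 1 p. 457): at every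
scale `0 < s ≤ r` the closed ball `B̄_s(z)` (with the restricted metric) admits an
`(ε s)`-Gromov–Hausdorff approximation (`IsGHApprox`: distortion `≤ ε s`, `(ε s)`-dense image) to the
closed Euclidean ball `B̄_s(0) ⊂ ℝⁿ`. Printed: "`d_GH(B_s(z), B_s(0)) < ε s` for all `s ∈ (0, u]`,
some `u > r`"; the renderings agree up to the factor `2` in `ε` and any shrinking of `r`
(module docstring, §3). [cite: CheegerColding1997, (4.6) p. 431 and Appendix 1 p. 457] -/
def IsReifenbergPoint {X : Type*} [PseudoMetricSpace X] (n : ℕ) (ε r : ℝ) (z : X) : Prop :=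
  ∀ ⦃s : ℝ⦄, 0 < s → s ≤ r →
    ∃ f : closedBall z s → closedBall (0 : EuclideanSpace ℝ (Fin n)) s, IsGHApprox (ε * s) f

/-- **`[X] ∈ 𝓜(n, ε, r)`: `X` is uniformly `(ε, r)`-Reifenberg** (Cheeger–Colding 1997, Appendix 1,
p. 457: "the collection of isometry classes of complete separable metric spaces `(Z, ρ)` such that
`z ∈ (ℛ_n)_{ε,r}` for all `z ∈ Z`"): every point of `X` is an `(ε, r)`-Reifenberg point
(`IsReifenbergPoint`), i.e. for all `z : X` and `0 < s ≤ r` the closed ball `B̄_s(z)` admits an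
`(ε s)`-GH approximation to the closed Euclidean ball `B̄_s(0) ⊂ ℝⁿ`. (Completeness and separability
are not part of the predicate; they are hypotheses of the theorems that consume it.)
[cite: CheegerColding1997, Appendix 1 p. 457 (the class 𝓜(n, ε, r))] -/
def IsUniformlyReifenberg (n : ℕ) (X : Type*) [PseudoMetricSpace X] (ε r : ℝ) : Prop :=
  ∀ z : X, IsReifenbergPoint n ε r z

variable {X : Type*} [PseudoMetricSpace X]

variable {n : ℕ} {ε ε' r r' : ℝ} {z : X}

/-- Unfolding lemma for `IsReifenbergPoint`. [folklore] -/
theorem isReifenbergPoint_iff : IsReifenbergPoint n ε r z ↔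
    ∀ ⦃s : ℝ⦄, 0 < s → s ≤ r →
      ∃ f : closedBall z s → closedBall (0 : EuclideanSpace ℝ (Fin n)) s, IsGHApprox (ε * s) f :=
  Iff.rfl

/-- Unfolding lemma for `IsUniformlyReifenberg`. [folklore] -/
theorem isUniformlyReifenberg_iff : IsUniformlyReifenberg n X ε r ↔
    ∀ (z : X) ⦃s : ℝ⦄, 0 < s → s ≤ r →
      ∃ f : closedBall z s → closedBall (0 : EuclideanSpace ℝ (Fin n)) s, IsGHApprox (ε * s) f :=
  Iff.rfl

/-- The approximation at scale `s` of a Reifenberg point. [folklore] -/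
theorem IsReifenbergPoint.exists_isGHApprox (h : IsReifenbergPoint n ε r z) {s : ℝ} (hs : 0 < s)
    (hsr : s ≤ r) :
    ∃ f : closedBall z s → closedBall (0 : EuclideanSpace ℝ (Fin n)) s, IsGHApprox (ε * s) f :=
  h hs hsr

/-- A uniformly Reifenberg space consists of Reifenberg points. [folklore] -/
theorem IsUniformlyReifenberg.isReifenbergPoint (h : IsUniformlyReifenberg n X ε r) (z : X) :
    IsReifenbergPoint n ε r z :=
  h z

/-- Monotonicity of `(ℛ_n)_{ε,r}`: increasing `ε` and decreasing `r` preserve Reifenberg points.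
[folklore] -/
theorem IsReifenbergPoint.mono (h : IsReifenbergPoint n ε r z) (hε : ε ≤ ε') (hr : r' ≤ r) :
    IsReifenbergPoint n ε' r' z := fun s hs hsr ↦ by
  obtain ⟨f, hf⟩ := h hs (hsr.trans hr)
  exact ⟨f, hf.mono (mul_le_mul_of_nonneg_right hε hs.le)⟩

/-- Monotonicity of `𝓜(n, ε, r)` in `ε` (increasing) and `r` (decreasing). [folklore] -/
theorem IsUniformlyReifenberg.mono (h : IsUniformlyReifenberg n X ε r) (hε : ε ≤ ε') (hr : r' ≤ r) :
    IsUniformlyReifenberg n X ε' r' :=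
  fun z ↦ (h z).mono hε hr

/-- For `r ≤ 0` there are no scales `0 < s ≤ r`: every point is an `(ε, r)`-Reifenberg point
(vacuity of the degenerate parameter range). [folklore] -/
theorem isReifenbergPoint_of_nonpos (hr : r ≤ 0) : IsReifenbergPoint n ε r z :=
  fun _ hs hsr ↦ absurd (hs.trans_le (hsr.trans hr)) (lt_irrefl 0)

variable (X) in
/-- For `r ≤ 0` every space is uniformly `(ε, r)`-Reifenberg (vacuously). [folklore] -/
theorem isUniformlyReifenberg_of_nonpos (hr : r ≤ 0) : IsUniformlyReifenberg n X ε r :=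
  fun _ ↦ isReifenbergPoint_of_nonpos hr

/-- At a positive scale the Reifenberg condition forces `0 ≤ ε` (the ball `B̄_s(z) ∋ z` is
nonempty). [folklore] -/
theorem IsReifenbergPoint.nonneg (h : IsReifenbergPoint n ε r z) (hr : 0 < r) : 0 ≤ ε := by
  obtain ⟨f, hf⟩ := h hr le_rfl
  have h0 : 0 ≤ ε * r := hf.nonneg ⟨z, mem_closedBall_self hr.le⟩
  exact nonneg_of_mul_nonneg_left h0 hr

/-- A nonempty uniformly `(ε, r)`-Reifenberg space with `r > 0` has `0 ≤ ε`. [folklore] -/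
theorem IsUniformlyReifenberg.nonneg (h : IsUniformlyReifenberg n X ε r) (hr : 0 < r) (z : X) :
    0 ≤ ε :=
  (h z).nonneg hr

/-! #### The global-map form -/

/-- **Global-map form of a Reifenberg point.** `z ∈ (ℛ_n)_{ε,r}` iff for every `0 < s ≤ r` there
is a map `φ : X → ℝⁿ` carrying `B̄_s(z)` into `B̄_s(0)`, with distortion `≤ ε s` on `B̄_s(z)` and
with every point of `B̄_s(0)` within `ε s` of `φ(B̄_s(z))`. (Extend a subtype approximation by `0`;
restrict a global map.) [folklore] -/
theorem isReifenbergPoint_iff_exists_map : IsReifenbergPoint n ε r z ↔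
    ∀ ⦃s : ℝ⦄, 0 < s → s ≤ r → ∃ φ : X → EuclideanSpace ℝ (Fin n),
      MapsTo φ (closedBall z s) (closedBall 0 s) ∧
      (∀ a ∈ closedBall z s, ∀ b ∈ closedBall z s, |dist (φ a) (φ b) - dist a b| ≤ ε * s) ∧
      ∀ v ∈ closedBall (0 : EuclideanSpace ℝ (Fin n)) s, ∃ a ∈ closedBall z s,
        dist (φ a) v ≤ ε * s := by
  classical
  refine ⟨fun h s hs hsr ↦ ?_, fun h s hs hsr ↦ ?_⟩
  · obtain ⟨f, hf⟩ := h hs hsr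
    refine ⟨fun a ↦ if ha : a ∈ closedBall z s then (f ⟨a, ha⟩ : EuclideanSpace ℝ (Fin n)) else 0,
      fun a ha ↦ by simp [ha], fun a ha b hb ↦ ?_, fun v hv ↦ ?_⟩
    · simpa [ha, hb, Subtype.dist_eq] using hf.1 ⟨a, ha⟩ ⟨b, hb⟩
    · obtain ⟨⟨a, ha⟩, hav⟩ := hf.2 ⟨v, hv⟩
      exact ⟨a, ha, by simpa [ha, Subtype.dist_eq] using hav⟩
  · obtain ⟨φ, hmaps, hdist, hdense⟩ := h hs hsr
    refine ⟨fun a ↦ ⟨φ a, hmaps a.2⟩, fun a b ↦ ?_, fun v ↦ ?_⟩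
    · simpa [Subtype.dist_eq] using hdist a a.2 b b.2
    · obtain ⟨a, ha, hav⟩ := hdense v v.2
      exact ⟨⟨a, ha⟩, by simpa [Subtype.dist_eq] using hav⟩

variable (X) in
/-- **Global-map form of the uniform Reifenberg condition**: for all `z` and `0 < s ≤ r` a map
`φ : X → ℝⁿ` with `φ(B̄_s(z)) ⊆ B̄_s(0)`, distortion `≤ ε s` on `B̄_s(z)` and `φ(B̄_s(z))`
`(ε s)`-dense in `B̄_s(0)`. [folklore] -/
theorem isUniformlyReifenberg_iff_exists_map : IsUniformlyReifenberg n X ε r ↔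
    ∀ (z : X) ⦃s : ℝ⦄, 0 < s → s ≤ r → ∃ φ : X → EuclideanSpace ℝ (Fin n),
      MapsTo φ (closedBall z s) (closedBall 0 s) ∧
      (∀ a ∈ closedBall z s, ∀ b ∈ closedBall z s, |dist (φ a) (φ b) - dist a b| ≤ ε * s) ∧
      ∀ v ∈ closedBall (0 : EuclideanSpace ℝ (Fin n)) s, ∃ a ∈ closedBall z s,
        dist (φ a) v ≤ ε * s :=
  forall_congr' fun _ ↦ isReifenbergPoint_iff_exists_map

end Basic

/-! #### Transport along distance-scaling bijections; scale behaviour -/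

section Transport

variable {X Y : Type*} [PseudoMetricSpace X] [PseudoMetricSpace Y] {n : ℕ} {ε r : ℝ}

/-- Scaling a closed Euclidean ball: `v ↦ c • v` maps `B̄_s(0)` onto `B̄_{c s}(0)` for `c > 0`.
[folklore] -/
theorem smul_mem_closedBall_zero_iff {E : Type*} [NormedAddCommGroup E] [NormedSpace ℝ E] {c : ℝ}
    (hc : 0 < c) (v : E) (s : ℝ) : c • v ∈ closedBall (0 : E) (c * s) ↔ v ∈ closedBall (0 : E) s := by
  rw [mem_closedBall_zero_iff, mem_closedBall_zero_iff, norm_smul, Real.norm_of_nonneg hc.le]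
  exact mul_le_mul_iff_right₀ hc

/-- **Transport along a distance-scaling bijection (scale behaviour).** If `e : X ≃ Y` multiplies
all distances by `c > 0` (`Y` is `X` with the metric `c ρ`) and `z ∈ (ℛ_n)_{ε,r}` in `X`, then
`e z ∈ (ℛ_n)_{ε, c r}` in `Y`: the Reifenberg condition is scale invariant in `ε` and the scale
parameter `r` dilates with the metric. (Pull the ball `B̄_s(e z)` back to `B̄_{s/c}(z)`, approximate,
and rescale the Euclidean ball by `c`.) [folklore] -/
theorem IsReifenbergPoint.of_equiv_of_dist_eq (e : X ≃ Y) {c : ℝ} (hc : 0 < c)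
    (he : ∀ x₁ x₂ : X, dist (e x₁) (e x₂) = c * dist x₁ x₂) {z : X}
    (h : IsReifenbergPoint n ε r z) : IsReifenbergPoint n ε (c * r) (e z) := by
  intro s hs hsr
  have hs' : 0 < s / c := div_pos hs hc
  have hsr' : s / c ≤ r := by rwa [div_le_iff₀ hc, mul_comm]
  have hcs : c * (s / c) = s := mul_div_cancel₀ s hc.ne'
  obtain ⟨f, hf⟩ := h hs' hsr'
  -- pull back points of `B̄_s(e z)` to `B̄_{s/c}(z)`
  have hmem : ∀ y ∈ closedBall (e z) s, e.symm y ∈ closedBall z (s / c) := fun y hy ↦ by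
    rw [mem_closedBall] at hy ⊢
    have h1 : dist y (e z) = c * dist (e.symm y) z := by
      conv_lhs => rw [← e.apply_symm_apply y]
      exact he _ _
    rw [le_div_iff₀ hc, mul_comm]
    linarith
  refine ⟨fun y ↦ ⟨c • (f ⟨e.symm y, hmem y y.2⟩ : EuclideanSpace ℝ (Fin n)), ?_⟩, ?_, ?_⟩
  · have hy := (smul_mem_closedBall_zero_iff hc _ _).2 (f ⟨e.symm y.1, hmem y.1 y.2⟩).2
    rwa [hcs] at hy
  · rintro ⟨y₁, hy₁⟩ ⟨y₂, hy₂⟩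
    have hd := hf.1 ⟨e.symm y₁, hmem y₁ hy₁⟩ ⟨e.symm y₂, hmem y₂ hy₂⟩
    have h1 : dist y₁ y₂ = c * dist (e.symm y₁) (e.symm y₂) := by
      conv_lhs => rw [← e.apply_symm_apply y₁, ← e.apply_symm_apply y₂]
      exact he _ _
    rw [Subtype.dist_eq, Subtype.dist_eq] at hd ⊢
    simp only [dist_smul₀, Real.norm_of_nonneg hc.le]
    rw [h1, ← mul_sub, abs_mul, abs_of_pos hc]
    calc c * |dist (f ⟨e.symm y₁, hmem y₁ hy₁⟩ : EuclideanSpace ℝ (Fin n))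
          (f ⟨e.symm y₂, hmem y₂ hy₂⟩) - dist (e.symm y₁) (e.symm y₂)| ≤ c * (ε * (s / c)) :=
          mul_le_mul_of_nonneg_left hd hc.le
      _ = ε * s := by rw [mul_left_comm, hcs]
  · rintro ⟨w, hw⟩
    have hw' : c⁻¹ • w ∈ closedBall (0 : EuclideanSpace ℝ (Fin n)) (s / c) := by
      rw [← smul_mem_closedBall_zero_iff hc, smul_inv_smul₀ hc.ne', hcs]
      exact hw
    obtain ⟨⟨x, hx⟩, hxw⟩ := hf.2 ⟨c⁻¹ • w, hw'⟩
    have hex : e x ∈ closedBall (e z) s := by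
      rw [mem_closedBall, he, ← hcs]
      exact mul_le_mul_of_nonneg_left (mem_closedBall.1 hx) hc.le
    refine ⟨⟨e x, hex⟩, ?_⟩
    have hxe : (⟨e.symm (e x), hmem (e x) hex⟩ : closedBall z (s / c)) = ⟨x, hx⟩ := by
      ext1
      exact e.symm_apply_apply x
    rw [Subtype.dist_eq] at hxw ⊢
    simp only
    rw [hxe]
    calc dist (c • (f ⟨x, hx⟩ : EuclideanSpace ℝ (Fin n))) w
        = dist (c • (f ⟨x, hx⟩ : EuclideanSpace ℝ (Fin n))) (c • c⁻¹ • w) := by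
          rw [smul_inv_smul₀ hc.ne']
      _ = c * dist (f ⟨x, hx⟩ : EuclideanSpace ℝ (Fin n)) (c⁻¹ • w) := by
          rw [dist_smul₀, Real.norm_of_nonneg hc.le]
      _ ≤ c * (ε * (s / c)) := mul_le_mul_of_nonneg_left hxw hc.le
      _ = ε * s := by rw [mul_left_comm, hcs]

/-- **Scale behaviour of `𝓜(n, ε, r)`**: if `e : X ≃ Y` multiplies distances by `c > 0` (i.e. `Y`
is `X` with the dilated metric `c ρ`), then `X ∈ 𝓜(n, ε, r)` implies `Y ∈ 𝓜(n, ε, c r)`.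
[folklore] -/
theorem IsUniformlyReifenberg.of_equiv_of_dist_eq (e : X ≃ Y) {c : ℝ} (hc : 0 < c)
    (he : ∀ x₁ x₂ : X, dist (e x₁) (e x₂) = c * dist x₁ x₂) (h : IsUniformlyReifenberg n X ε r) :
    IsUniformlyReifenberg n Y ε (c * r) := fun y ↦ by
  simpa using (h (e.symm y)).of_equiv_of_dist_eq e hc he

/-- Scale behaviour along a Mathlib dilation equivalence `e : X ≃ᵈ Y` (ratio `λ = ratio e`):
`X ∈ 𝓜(n, ε, r) → Y ∈ 𝓜(n, ε, λ r)`. [folklore] -/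
theorem IsUniformlyReifenberg.of_dilationEquiv (e : X ≃ᵈ Y) (h : IsUniformlyReifenberg n X ε r) :
    IsUniformlyReifenberg n Y ε (Dilation.ratio e * r) :=
  h.of_equiv_of_dist_eq e.toEquiv (by exact_mod_cast Dilation.ratio_pos e)
    fun x₁ x₂ ↦ Dilation.dist_eq e x₁ x₂

/-- **Isometry invariance**: `𝓜(n, ε, r)` is a class of isometry classes — an isometric
equivalence transports the uniform Reifenberg condition. [folklore] -/
theorem IsUniformlyReifenberg.of_isometryEquiv (e : X ≃ᵢ Y) (h : IsUniformlyReifenberg n X ε r) :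
    IsUniformlyReifenberg n Y ε r := by
  simpa using h.of_equiv_of_dist_eq e.toEquiv one_pos fun x₁ x₂ ↦ by
    simpa using e.dist_eq x₁ x₂

/-- Isometry invariance, `iff` form. [folklore] -/
theorem IsometryEquiv.isUniformlyReifenberg_iff (e : X ≃ᵢ Y) :
    IsUniformlyReifenberg n X ε r ↔ IsUniformlyReifenberg n Y ε r :=
  ⟨fun h ↦ h.of_isometryEquiv e, fun h ↦ h.of_isometryEquiv e.symm⟩

end Transport

/-! ### §2. The model: Euclidean space is uniformly Reifenberg at every scale -/

section Euclidean

variable {n : ℕ} {ε : ℝ}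

/-- **`ℝⁿ ∈ 𝓜(n, ε, r)` for every `ε ≥ 0` and every `r`**: the translate `x ↦ x - z` is an
isometry of `B̄_s(z)` onto `B̄_s(0)`, a `0`-approximation. [folklore] -/
theorem isUniformlyReifenberg_euclideanSpace (hε : 0 ≤ ε) (r : ℝ) :
    IsUniformlyReifenberg n (EuclideanSpace ℝ (Fin n)) ε r := by
  intro z s hs _
  refine ⟨fun x ↦ ⟨(x : EuclideanSpace ℝ (Fin n)) - z, ?_⟩, ?_⟩
  · rw [mem_closedBall_zero_iff, ← dist_eq_norm]
    exact x.2
  · refine (isGHApprox_of_dist_eq_of_surjective (fun x₁ x₂ ↦ ?_) (fun y ↦ ?_) le_rfl).mono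
      (mul_nonneg hε hs.le)
    · rw [Subtype.dist_eq, Subtype.dist_eq]
      exact dist_sub_right _ _ _
    · refine ⟨⟨(y : EuclideanSpace ℝ (Fin n)) + z, ?_⟩, ?_⟩
      · rw [mem_closedBall, dist_eq_norm, add_sub_cancel_right]
        exact mem_closedBall_zero_iff.1 y.2
      · ext1
        simp

/-- **Every `n`-dimensional real inner product space is uniformly `(ε, r)`-Reifenberg** for all
`ε ≥ 0` and all `r` (an orthonormal frame identifies it isometrically with `ℝⁿ`). [folklore] -/
theorem isUniformlyReifenberg_of_finrank_eq {E : Type*} [NormedAddCommGroup E]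
    [InnerProductSpace ℝ E] [FiniteDimensional ℝ E] (hE : Module.finrank ℝ E = n) (hε : 0 ≤ ε)
    (r : ℝ) : IsUniformlyReifenberg n E ε r := by
  let b : OrthonormalBasis (Fin n) ℝ E := (stdOrthonormalBasis ℝ E).reindex (finCongr hE)
  exact (isUniformlyReifenberg_euclideanSpace hε r).of_isometryEquiv
    b.repr.toIsometryEquiv.symm

/-- **Any `n`-dimensional Euclidean model will do**: to verify that `z` is an `(ε, r)`-Reifenberg
point it suffices to `(ε s)`-approximate each `B̄_s(z)`, `0 < s ≤ r`, by the closed ball `B̄_s(0)` of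
SOME `n`-dimensional real inner product space `E` (an orthonormal frame of `E` is a linear isometry
onto `ℝⁿ` carrying `B̄_s(0)` onto `B̄_s(0)`, a `0`-approximation to compose with). Used with `E` a
tangent space / a hyperplane. [folklore] -/
theorem isReifenbergPoint_of_finrank_eq {X : Type*} [PseudoMetricSpace X] {E : Type*}
    [NormedAddCommGroup E] [InnerProductSpace ℝ E] [FiniteDimensional ℝ E]
    (hE : Module.finrank ℝ E = n) {r : ℝ} {z : X}
    (H : ∀ ⦃s : ℝ⦄, 0 < s → s ≤ r →
      ∃ f : closedBall z s → closedBall (0 : E) s, IsGHApprox (ε * s) f) :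
    IsReifenbergPoint n ε r z := by
  intro s hs hsr
  obtain ⟨f, hf⟩ := H hs hsr
  let b : OrthonormalBasis (Fin n) ℝ E := (stdOrthonormalBasis ℝ E).reindex (finCongr hE)
  let ι : closedBall (0 : E) s → closedBall (0 : EuclideanSpace ℝ (Fin n)) s :=
    fun v ↦ ⟨b.repr v, by rw [mem_closedBall_zero_iff, b.repr.norm_map]; exact
      mem_closedBall_zero_iff.1 v.2⟩
  have hι : IsGHApprox 0 ι := by
    refine isGHApprox_of_dist_eq_of_surjective (fun v w ↦ ?_) (fun w ↦ ?_) le_rfl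
    · rw [Subtype.dist_eq, Subtype.dist_eq]
      exact b.repr.dist_map _ _
    · refine ⟨⟨b.repr.symm w, ?_⟩, ?_⟩
      · rw [mem_closedBall_zero_iff, b.repr.symm.norm_map]
        exact mem_closedBall_zero_iff.1 w.2
      · ext1
        simp [ι]
  exact ⟨ι ∘ f, by simpa using hι.comp hf⟩

end Euclidean

/-! ### §3. Bridge to the printed `d_GH`-form (Mathlib's `GromovHausdorff.ghDist`) -/

section GHBridge

variable {X : Type*} [MetricSpace X] {n : ℕ} {ε r : ℝ}

/-- Closed balls of nonnegative radius are nonempty (instance form, for `ghDist`). [folklore] -/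
theorem nonempty_coe_closedBall {z : X} {s : ℝ} (hs : 0 ≤ s) : Nonempty (closedBall z s) :=
  ⟨⟨z, mem_closedBall_self hs⟩⟩

/-- Closed balls of a proper space are compact (instance form, for `ghDist`). [folklore] -/
theorem compactSpace_coe_closedBall [ProperSpace X] (z : X) (s : ℝ) :
    CompactSpace (closedBall z s) :=
  isCompact_iff_compactSpace.1 (isCompact_closedBall z s)

/-- **The printed (4.6)-form on a proper metric space**: `X ∈ 𝓜(n, ε, r)` literally as in
Cheeger–Colding 1997 (up to closed balls and the range of scales, module docstring):
`d_GH(B̄_s(z), B̄_s(0)) < ε s` for all `z ∈ X` and `0 < s ≤ r`, with Mathlib's Gromov–Hausdorff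
distance of the compact metric spaces `B̄_s(z) ⊆ X` and `B̄_s(0) ⊆ ℝⁿ`.
[cite: CheegerColding1997, (4.6) p. 431 and Appendix 1 p. 457] -/
def IsUniformlyReifenbergGH (n : ℕ) (X : Type*) [MetricSpace X] [ProperSpace X] (ε r : ℝ) :
    Prop :=
  ∀ (z : X) ⦃s : ℝ⦄ (hs : 0 < s), s ≤ r →
    haveI := nonempty_coe_closedBall (z := z) hs.le
    haveI := compactSpace_coe_closedBall z s
    haveI := nonempty_coe_closedBall (X := EuclideanSpace ℝ (Fin n)) (z := 0) hs.le
    haveI := compactSpace_coe_closedBall (0 : EuclideanSpace ℝ (Fin n)) s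
    GromovHausdorff.ghDist (closedBall z s) (closedBall (0 : EuclideanSpace ℝ (Fin n)) s) < ε * s

/-- **Approximations bound `d_GH`**: at a Reifenberg point, `d_GH(B̄_s(z), B̄_s(0)) ≤ (3/2) ε s` for
`0 < s ≤ r`, whenever the two closed balls are compact (e.g. in a proper space), by
`IsGHApprox.ghDist_le`. [cite: Colding1997Aspects, Def. 2.1 and the remark following it] -/
theorem IsReifenbergPoint.ghDist_le {z : X} (h : IsReifenbergPoint n ε r z) {s : ℝ} (hs : 0 < s)
    (hsr : s ≤ r) [CompactSpace (closedBall z s)] [Nonempty (closedBall z s)]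
    [CompactSpace (closedBall (0 : EuclideanSpace ℝ (Fin n)) s)]
    [Nonempty (closedBall (0 : EuclideanSpace ℝ (Fin n)) s)] :
    GromovHausdorff.ghDist (closedBall z s) (closedBall (0 : EuclideanSpace ℝ (Fin n)) s) ≤
      3 / 2 * (ε * s) := by
  obtain ⟨f, hf⟩ := h hs hsr
  have := hf.ghDist_le
  linarith

/-- **`𝓜(n, ε, r)` in the approximation form implies the printed form with `2ε`** on proper metric
spaces (`ε > 0`; the constant is `3/2 < 2`). [cite: Colding1997Aspects, Def. 2.1 and the remark following it] -/
theorem IsUniformlyReifenberg.isUniformlyReifenbergGH [ProperSpace X]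
    (h : IsUniformlyReifenberg n X ε r) (hε : 0 < ε) : IsUniformlyReifenbergGH n X (2 * ε) r := by
  intro z s hs hsr
  haveI := nonempty_coe_closedBall (z := z) hs.le
  haveI := compactSpace_coe_closedBall z s
  haveI := nonempty_coe_closedBall (X := EuclideanSpace ℝ (Fin n)) (z := 0) hs.le
  haveI := compactSpace_coe_closedBall (0 : EuclideanSpace ℝ (Fin n)) s
  have h1 := (h z).ghDist_le hs hsr
  have h2 : 3 / 2 * (ε * s) < 2 * ε * s := by nlinarith [mul_pos hε hs]
  exact h1.trans_lt h2

/-- **The printed form implies the approximation form with `2ε`** on proper metric spaces: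
`d_GH(B̄_s(z), B̄_s(0)) < ε s` yields a `(2 ε s)`-approximation `B̄_s(z) → B̄_s(0)` through Mathlib's
optimal coupling (`exists_isGHApprox_of_ghDist_lt`). [cite: Colding1997Aspects, Def. 2.1 and the remark following it] -/
theorem IsUniformlyReifenbergGH.isUniformlyReifenberg [ProperSpace X]
    (h : IsUniformlyReifenbergGH n X ε r) : IsUniformlyReifenberg n X (2 * ε) r := by
  intro z s hs hsr
  haveI := nonempty_coe_closedBall (z := z) hs.le
  haveI := compactSpace_coe_closedBall z s
  haveI := nonempty_coe_closedBall (X := EuclideanSpace ℝ (Fin n)) (z := 0) hs.le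
  haveI := compactSpace_coe_closedBall (0 : EuclideanSpace ℝ (Fin n)) s
  obtain ⟨f, hf⟩ := exists_isGHApprox_of_ghDist_lt (closedBall z s)
    (closedBall (0 : EuclideanSpace ℝ (Fin n)) s) (h z hs hsr)
  exact ⟨f, by simpa [mul_assoc] using hf⟩

end GHBridge

/-! ### §4. The Riemannian specialisation -/

section Riemannian

open scoped Manifold ContDiff
open Bundle Manifold

variable {n : ℕ} {M : Type*} [TopologicalSpace M] [ChartedSpace (EuclideanSpace ℝ (Fin n)) M]
  [IsManifold (𝓡 n) ∞ M]

variable (n) in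
/-- **Uniformly `(ε, r)`-Reifenberg Riemannian manifold**: for a `C^∞` Riemannian metric `h` on
the connected `T₃` (e.g. Hausdorff) `n`-manifold `M`, the metric space `(M, d_h)` — Mathlib's
length distance `d_h = Manifold.riemannianEDist` of `h`, finite on connected manifolds, as the
metric space structure `metricSpaceOfRiemannian` — belongs to `𝓜(n, ε, r)`
(`IsUniformlyReifenberg`): every closed `d_h`-ball `B̄_s(z)`, `0 < s ≤ r`, admits an
`(ε s)`-Gromov–Hausdorff approximation to `B̄_s(0) ⊂ ℝⁿ`. This is the hypothesis "`Z` is an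
`n`-dimensional Riemannian manifold [with] `[Z] ∈ 𝓜(n, ε, r)`" of Cheeger–Colding 1997, Thms
A.1.1–A.1.3 (p. 457). [cite: CheegerColding1997, Appendix 1 p. 457 (𝓜(n, ε, r)), Thms A.1.2–A.1.3] -/
def IsUniformlyReifenbergRiem [T3Space M] [PreconnectedSpace M]
    (h : ContMDiffRiemannianMetric (𝓡 n) ∞ (EuclideanSpace ℝ (Fin n))
      (TangentSpace (𝓡 n) : M → Type _)) (ε r : ℝ) : Prop :=
  letI : RiemannianBundle (fun x : M ↦ TangentSpace (𝓡 n) x) :=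
    ⟨h.toContinuousRiemannianMetric.toRiemannianMetric⟩
  letI : MetricSpace M := metricSpaceOfRiemannian (𝓡 n) M
  IsUniformlyReifenberg n M ε r

variable [T3Space M] [PreconnectedSpace M]
  {h : ContMDiffRiemannianMetric (𝓡 n) ∞ (EuclideanSpace ℝ (Fin n))
    (TangentSpace (𝓡 n) : M → Type _)} {ε ε' r r' : ℝ}

/-- Unfolding: `IsUniformlyReifenbergRiem n h ε r` is `IsUniformlyReifenberg` of `(M, d_h)`.
[folklore] -/
theorem isUniformlyReifenbergRiem_iff :
    IsUniformlyReifenbergRiem n h ε r ↔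
      letI : RiemannianBundle (fun x : M ↦ TangentSpace (𝓡 n) x) :=
        ⟨h.toContinuousRiemannianMetric.toRiemannianMetric⟩
      letI : MetricSpace M := metricSpaceOfRiemannian (𝓡 n) M
      IsUniformlyReifenberg n M ε r :=
  Iff.rfl

/-- Monotonicity of the Riemannian uniform Reifenberg condition in `ε` and `r`. [folklore] -/
theorem IsUniformlyReifenbergRiem.mono (H : IsUniformlyReifenbergRiem n h ε r) (hε : ε ≤ ε')
    (hr : r' ≤ r) : IsUniformlyReifenbergRiem n h ε' r' := by
  letI : RiemannianBundle (fun x : M ↦ TangentSpace (𝓡 n) x) :=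
    ⟨h.toContinuousRiemannianMetric.toRiemannianMetric⟩
  letI : MetricSpace M := metricSpaceOfRiemannian (𝓡 n) M
  exact IsUniformlyReifenberg.mono H hε hr

/-- **The Riemannian condition in terms of `riemannianEDist`** (the form used by the cruxes of
`CheegerColding1997_sphereStability`): for all `z` and `0 < s ≤ r` there is `φ : M → ℝⁿ` with
`‖φ a‖ ≤ s` whenever `d_h(z, a) ≤ s`, distortion `|‖φ a - φ b‖ - d_h(a, b)| ≤ ε s` for
`d_h(z, a), d_h(z, b) ≤ s`, and for every `‖v‖ ≤ s` some `a` with `d_h(z, a) ≤ s` and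
`‖φ a - v‖ ≤ ε s`; here `d_h(a, b) = (riemannianEDist (𝓡 n) a b).toReal`. [folklore] -/
theorem isUniformlyReifenbergRiem_iff_exists_map :
    IsUniformlyReifenbergRiem n h ε r ↔
      letI : RiemannianBundle (fun x : M ↦ TangentSpace (𝓡 n) x) :=
        ⟨h.toContinuousRiemannianMetric.toRiemannianMetric⟩
      ∀ (z : M) ⦃s : ℝ⦄, 0 < s → s ≤ r → ∃ φ : M → EuclideanSpace ℝ (Fin n),
        (∀ a : M, (riemannianEDist (𝓡 n) z a).toReal ≤ s → ‖φ a‖ ≤ s) ∧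
        (∀ a b : M, (riemannianEDist (𝓡 n) z a).toReal ≤ s →
          (riemannianEDist (𝓡 n) z b).toReal ≤ s →
            |dist (φ a) (φ b) - (riemannianEDist (𝓡 n) a b).toReal| ≤ ε * s) ∧
        ∀ v : EuclideanSpace ℝ (Fin n), ‖v‖ ≤ s →
          ∃ a : M, (riemannianEDist (𝓡 n) z a).toReal ≤ s ∧ dist (φ a) v ≤ ε * s := by
  letI : RiemannianBundle (fun x : M ↦ TangentSpace (𝓡 n) x) :=
    ⟨h.toContinuousRiemannianMetric.toRiemannianMetric⟩
  letI : MetricSpace M := metricSpaceOfRiemannian (𝓡 n) M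
  rw [isUniformlyReifenbergRiem_iff, isUniformlyReifenberg_iff_exists_map]
  refine forall_congr' fun z ↦ forall₃_congr fun s hs hsr ↦ exists_congr fun φ ↦ ?_
  have hmem : ∀ a : M, a ∈ closedBall z s ↔ (riemannianEDist (𝓡 n) z a).toReal ≤ s := fun a ↦ by
    rw [mem_closedBall, dist_comm, dist_metricSpaceOfRiemannian]
  refine and_congr ⟨fun H a ha ↦ mem_closedBall_zero_iff.1 (H ((hmem a).2 ha)),
    fun H a ha ↦ mem_closedBall_zero_iff.2 (H a ((hmem a).1 ha))⟩ (and_congr ⟨fun H a b ha hb ↦ ?_,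
    fun H a ha b hb ↦ ?_⟩ (forall_congr' fun v ↦ ⟨fun H hv ↦ ?_, fun H hv ↦ ?_⟩))
  · have h1 := H a ((hmem a).2 ha) b ((hmem b).2 hb)
    rwa [dist_metricSpaceOfRiemannian (I := 𝓡 n) a b] at h1
  · have h1 := H a b ((hmem a).1 ha) ((hmem b).1 hb)
    rwa [← dist_metricSpaceOfRiemannian (I := 𝓡 n) a b] at h1
  · obtain ⟨a, ha, hav⟩ := H (mem_closedBall_zero_iff.2 hv)
    exact ⟨a, (hmem a).1 ha, hav⟩
  · obtain ⟨a, ha, hav⟩ := H (mem_closedBall_zero_iff.1 hv)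
    exact ⟨a, (hmem a).2 ha, hav⟩

end Riemannian

end Literature.Geometry.Riemannian

end
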